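import Literature.Algebra.Semigroups.FullTransformationGreen

/-!
# Units, zeros, regular elements, inverses and idempotents of `𝒯ₙ`

Source: O. Ganyushkin, V. Mazorchuk, *Classical Finite Transformation Semigroups*, Algebra and
Applications 9, Springer (2009) [GanyushkinMazorchuk2009], Chapter 2 "The semigroups `𝒯ₙ`,
`𝒫𝒯ₙ` and `ℐ𝒮ₙ`": Proposition 2.2.4 (§2.2), Proposition 2.3.3 (§2.3), Proposition 2.6.2,
Theorems 2.6.3, 2.6.4 (§2.6), Theorem 2.7.2, Corollary 2.7.4, Exercise 2.7.8 (b) and the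
remark on `ab`, `ba` before Theorem 2.7.6 (§2.7) — for the full transformation monoid
`𝒯(X) = (X → X, ∘)` (the `𝒯ₙ` case; `n = Nat.card X`).

Conventions as in `Literature.Algebra.Semigroups.FullTransformationGreen` (`(βα)(x) = β(α(x))`,
`im α = Set.range α`, `rank α = (Set.range α).ncard`); notions are spelled out, no definitions:

* Proposition 2.2.4: `α` is invertible in `𝒯(X)` iff it is a permutation
  (`exists_inverse_iff_bijective`);
* Proposition 2.3.3: the left zeros of `𝒯(X)` are the constant maps `0_a`, there are `n` of
  them, and for `n > 1` there is no right zero (`isLeftZero_iff`, `ncard_leftZeros`,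
  `not_isRightZero`);
* Proposition 2.6.2: if `aba = a` then `a` and `bab` are a pair of inverse elements (any
  semigroup; `inversePair_of_regular`); the idempotents `ab`, `ba` (`idempotent_mul_of_regular`);
* Theorem 2.6.3: `𝒯(X)` is regular (`exists_comp_comp_eq_self`);
* Theorem 2.6.4 (for `𝒯ₙ`, where condition (a) is void): `β` is inverse to `α` iff
  `β(a) ∈ α⁻¹(a)` for `a ∈ im α` and `im β = β(im α)` (`inversePair_iff`);
* Theorem 2.7.2: `α` is an idempotent iff `α` restricted to `im α` is the identity
  (`comp_self_eq_iff`);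
* Corollary 2.7.4: `𝒯ₙ` contains `∑_{k=1}^{n} (n choose k) k^{n-k}` idempotents
  (`card_idempotents`), via the count `(n choose k)·k^{n-k}` of idempotents with a given image
  of size `k` (`card_idempotents_image_eq`);
* Exercise 2.7.8 (b): for `n ≥ 3` the idempotents of `𝒯ₙ` are not closed under composition
  (`exists_idempotents_comp_not_idempotent`).
-/

namespace Literature.Algebra.Semigroups.FullTransformation

open Function Set

variable {X : Type*}

/-! ### Proposition 2.2.4: units -/

/-- **Proposition 2.2.4** (case `𝒯ₙ`): `α ∈ 𝒯(X)` is invertible (`αβ = βα = ε` for some `β`)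
iff `α` is a permutation of `X`, i.e. a bijection (cf. Mathlib
`Function.bijective_iff_has_inverse`). [cite: GanyushkinMazorchuk2009, Proposition 2.2.4] -/
theorem exists_inverse_iff_bijective (α : X → X) :
    (∃ β : X → X, α ∘ β = id ∧ β ∘ α = id) ↔ Bijective α := by
  rw [bijective_iff_has_inverse]
  constructor
  · rintro ⟨β, h1, h2⟩
    exact ⟨β, fun x => congrFun h2 x, fun x => congrFun h1 x⟩
  · rintro ⟨β, h1, h2⟩
    exact ⟨β, funext h2, funext h1⟩

/-! ### Proposition 2.3.3: zeros -/

/-- **Proposition 2.3.3** (case `𝒯ₙ`, `n ≥ 1`): `α` is a left zero of `𝒯(X)` (`αβ = α` for all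
`β`) iff `α = 0_a` is a constant transformation.
[cite: GanyushkinMazorchuk2009, Proposition 2.3.3] -/
theorem isLeftZero_iff [Nonempty X] (α : X → X) :
    (∀ β : X → X, α ∘ β = α) ↔ ∃ a : X, α = const X a := by
  constructor
  · intro h
    inhabit X
    refine ⟨α default, funext fun x => ?_⟩
    have := congrFun (h (const X default)) x
    simpa using this.symm
  · rintro ⟨a, rfl⟩ β
    rfl

/-- **Proposition 2.3.3** (case `𝒯ₙ`): for `n > 1` the semigroup `𝒯(X)` has no right zero
(no `α` with `βα = α` for all `β`). [cite: GanyushkinMazorchuk2009, Proposition 2.3.3] -/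
theorem not_isRightZero [Nontrivial X] (α : X → X) : ¬ ∀ β : X → X, β ∘ α = α := by
  intro h
  inhabit X
  obtain ⟨b, hb⟩ := exists_ne (α default)
  have := congrFun (h (const X b)) default
  exact hb this

/-- **Proposition 2.3.3** (case `𝒯ₙ`, `n ≥ 1`): `𝒯ₙ` contains exactly `n` left zeros, the
constant maps `0_a`, `a ∈ X`. [cite: GanyushkinMazorchuk2009, Proposition 2.3.3] -/
theorem ncard_leftZeros [Nonempty X] :
    {α : X → X | ∀ β : X → X, α ∘ β = α}.ncard = Nat.card X := by
  have h : {α : X → X | ∀ β : X → X, α ∘ β = α} = range (fun a : X => const X a) := by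
    ext α
    rw [mem_setOf_eq, isLeftZero_iff, mem_range]
    simp only [eq_comm]
  rw [h, ncard_range_of_injective]
  intro a b hab
  inhabit X
  exact congrFun hab default

/-! ### §2.6: regular and inverse elements -/

/-- **Proposition 2.6.2** (any semigroup): if `aba = a` then `a` and `c = bab` form a pair of
inverse elements: `aca = a` and `cac = c`. [cite: GanyushkinMazorchuk2009, Proposition 2.6.2] -/
theorem inversePair_of_regular {S : Type*} [Semigroup S] {a b : S} (h : a * b * a = a) :
    a * (b * a * b) * a = a ∧ (b * a * b) * a * (b * a * b) = b * a * b := by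
  constructor
  · calc a * (b * a * b) * a = (a * b * a) * b * a := by simp only [mul_assoc]
      _ = a := by rw [h, h]
  · calc (b * a * b) * a * (b * a * b) = b * ((a * b * a) * b * a) * b := by simp only [mul_assoc]
      _ = b * a * b := by rw [h, h]

/-- §2.7 (before Theorem 2.7.6, any semigroup): if `aba = a` then `ab` and `ba` are idempotents.
[cite: GanyushkinMazorchuk2009, §2.7] -/
theorem idempotent_mul_of_regular {S : Type*} [Semigroup S] {a b : S} (h : a * b * a = a) :
    (a * b) * (a * b) = a * b ∧ (b * a) * (b * a) = b * a := by
  constructor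
  · calc (a * b) * (a * b) = (a * b * a) * b := by simp only [mul_assoc]
      _ = a * b := by rw [h]
  · calc (b * a) * (b * a) = b * (a * b * a) := by simp only [mul_assoc]
      _ = b * a := by rw [h]

/-- **Theorem 2.6.3** (case `𝒯ₙ`): the full transformation semigroup is regular — for every
`α` there is `β` with `αβα = α` (`β` sends each `x ∈ im α` to one of its preimages).
[cite: GanyushkinMazorchuk2009, Theorem 2.6.3] -/
theorem exists_comp_comp_eq_self (α : X → X) : ∃ β : X → X, α ∘ β ∘ α = α := by
  rcases isEmpty_or_nonempty X with hX | hX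
  · exact ⟨α, funext fun x => isEmptyElim x⟩
  · exact ⟨invFun α, funext fun x => invFun_eq ⟨x, rfl⟩⟩

/-- **Theorem 2.6.4** (case `𝒯ₙ`; condition (a) `dom β ⊇ im α` is automatic): `β` is an inverse
of `α` (`αβα = α` and `βαβ = β`) iff (b) `β(a) ∈ {x : α(x) = a}` for all `a ∈ im α` and
(c) `im β = β(im α)`. [cite: GanyushkinMazorchuk2009, Theorem 2.6.4] -/
theorem inversePair_iff (α β : X → X) :
    (α ∘ β ∘ α = α ∧ β ∘ α ∘ β = β) ↔
      (∀ a ∈ range α, α (β a) = a) ∧ range β = β '' range α := by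
  constructor
  · rintro ⟨h1, h2⟩
    refine ⟨?_, Subset.antisymm ?_ ?_⟩
    · rintro _ ⟨x, rfl⟩
      exact congrFun h1 x
    · rintro _ ⟨x, rfl⟩
      exact ⟨α (β x), ⟨β x, rfl⟩, congrFun h2 x⟩
    · rintro _ ⟨a, -, rfl⟩
      exact ⟨a, rfl⟩
  · rintro ⟨hb, hc⟩
    refine ⟨funext fun x => hb _ ⟨x, rfl⟩, funext fun x => ?_⟩
    obtain ⟨a, ha, hax⟩ : β x ∈ β '' range α := hc ▸ mem_range_self x
    simp only [comp_apply]
    rw [← hax, hb a ha]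

/-! ### §2.7: idempotents of `𝒯ₙ` -/

/-- **Theorem 2.7.2** (case `𝒯ₙ`): `α` is an idempotent iff the restriction of `α` to `im α`
is the identity. [cite: GanyushkinMazorchuk2009, Theorem 2.7.2] -/
theorem comp_self_eq_iff (α : X → X) : α ∘ α = α ↔ ∀ y ∈ range α, α y = y := by
  constructor
  · rintro h _ ⟨x, rfl⟩
    exact congrFun h x
  · intro h
    exact funext fun x => h _ ⟨x, rfl⟩

/-- **Exercise 2.7.8 (b)**: for `n ≥ 3` the set `E(𝒯ₙ)` of idempotents is not a subsemigroup:
with three distinct points `a, b, c`, the idempotents `ε₁ = [b ↦ a]` and `ε₂ = [a ↦ c]` (all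
other points fixed) have the non-idempotent product `ε₁ε₂` (`a ↦ c`, `b ↦ a`, so
`(ε₁ε₂)²(b) = c ≠ a = (ε₁ε₂)(b)`). [cite: GanyushkinMazorchuk2009, Exercise 2.7.8 (b)] -/
theorem exists_idempotents_comp_not_idempotent {a b c : X} (hab : a ≠ b) (hbc : b ≠ c)
    (hac : a ≠ c) :
    ∃ ε₁ ε₂ : X → X, ε₁ ∘ ε₁ = ε₁ ∧ ε₂ ∘ ε₂ = ε₂ ∧ (ε₁ ∘ ε₂) ∘ (ε₁ ∘ ε₂) ≠ ε₁ ∘ ε₂ := by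
  classical
  refine ⟨update id b a, update id a c, ?_, ?_, ?_⟩
  · funext x
    by_cases hx : x = b
    · subst hx; simp [hab]
    · simp [hx]
  · funext x
    by_cases hx : x = a
    · subst hx; simp [hac.symm]
    · simp [hx]
  · intro h
    have := congrFun h b
    simp [hab.symm, hbc.symm] at this
    exact hac this.symm

/-- **Corollary 2.7.4**, the count for a fixed image (case `𝒯ₙ`): the idempotents of `𝒯(X)`
with image a given subset `A` correspond to the arbitrary maps `X \ A → A`; hence there are
`|A| ^ (n - |A|)` of them. [cite: GanyushkinMazorchuk2009, Corollary 2.7.4] -/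
theorem card_idempotents_image_eq [Fintype X] [DecidableEq X] (A : Finset X) :
    Fintype.card {α : X → X // α ∘ α = α ∧ Finset.univ.image α = A} =
      A.card ^ (Fintype.card X - A.card) := by
  -- the bijection with maps `Aᶜ → A`
  have key : ∀ α : X → X, (α ∘ α = α ∧ Finset.univ.image α = A) ↔
      (∀ x, α x ∈ A) ∧ ∀ x ∈ A, α x = x := by
    intro α
    constructor
    · rintro ⟨h1, rfl⟩
      refine ⟨fun x => Finset.mem_image_of_mem α (Finset.mem_univ x), fun x hx => ?_⟩
      obtain ⟨y, -, rfl⟩ := Finset.mem_image.1 hx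
      exact congrFun h1 y
    · rintro ⟨h1, h2⟩
      refine ⟨funext fun x => h2 _ (h1 x), ?_⟩
      ext y
      simp only [Finset.mem_image, Finset.mem_univ, true_and]
      exact ⟨by rintro ⟨x, rfl⟩; exact h1 x, fun hy => ⟨y, h2 y hy⟩⟩
  let e : {α : X → X // α ∘ α = α ∧ Finset.univ.image α = A} ≃ (↥(Aᶜ) → ↥A) :=
    { toFun := fun α x => ⟨α.1 x.1, ((key α.1).1 α.2).1 x.1⟩
      invFun := fun g => ⟨fun x => if hx : x ∈ A then x else (g ⟨x, Finset.mem_compl.2 hx⟩ : X),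
        (key _).2 ⟨fun x => by
          by_cases hx : x ∈ A
          · simp [hx]
          · simp [hx], fun x hx => by simp [hx]⟩⟩
      left_inv := by
        rintro ⟨α, hα⟩
        ext x
        by_cases hx : x ∈ A
        · simp [hx, ((key α).1 hα).2 x hx]
        · simp [hx]
      right_inv := by
        intro g
        funext x
        have hx : (x : X) ∉ A := Finset.mem_compl.1 x.2
        ext
        simp [hx] }
  rw [Fintype.card_congr e, Fintype.card_fun, Fintype.card_coe, Fintype.card_coe,
    Finset.card_compl]

/-- **Corollary 2.7.4**: the number `uₙ` of idempotents of the full transformation semigroup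
`𝒯ₙ` (`n ≥ 1`) is `uₙ = ∑_{k=1}^{n} (n choose k) k^{n-k}` — choose the `k`-element image, then
an arbitrary map from its complement into it. [cite: GanyushkinMazorchuk2009, Corollary 2.7.4] -/
theorem card_idempotents [Fintype X] [DecidableEq X] [Nonempty X] :
    Fintype.card {α : X → X // α ∘ α = α} =
      ∑ k ∈ Finset.Icc 1 (Fintype.card X), (Fintype.card X).choose k * k ^ (Fintype.card X - k) := by
  -- sort the idempotents by their image
  have h1 : Fintype.card {α : X → X // α ∘ α = α} =
      ∑ A : Finset X, Fintype.card {α : X → X // α ∘ α = α ∧ Finset.univ.image α = A} := by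
    rw [Fintype.card_subtype]
    rw [Finset.card_eq_sum_card_fiberwise (f := fun α : X → X => Finset.univ.image α)
      (t := Finset.univ) (fun _ _ => Finset.mem_coe.2 (Finset.mem_univ _))]
    refine Finset.sum_congr rfl fun A _ => ?_
    rw [Fintype.card_subtype, Finset.filter_filter]
  rw [h1]
  simp_rw [card_idempotents_image_eq]
  -- group the subsets by cardinality
  have h2 : ∑ A : Finset X, A.card ^ (Fintype.card X - A.card) =
      ∑ k ∈ Finset.range (Fintype.card X + 1),
        (Fintype.card X).choose k * k ^ (Fintype.card X - k) := by
    have := Finset.sum_powerset_apply_card (fun k => k ^ (Fintype.card X - k))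
      (x := (Finset.univ : Finset X))
    simpa only [Finset.powerset_univ, Finset.card_univ, smul_eq_mul] using this
  rw [h2, Finset.range_eq_Ico, Finset.sum_eq_sum_Ico_succ_bot (Nat.succ_pos _),
    zero_add, Nat.succ_eq_add_one, Finset.Ico_add_one_right_eq_Icc]
  simp

end Literature.Algebra.Semigroups.FullTransformation
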